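import Summits.CriticalPhenomena.PercolationContinuityZ3.Theorems.Transplant.GrigorchukWitnessSlabLogEngine
import Summits.CriticalPhenomena.PercolationContinuityZ3.Theorems.Transplant.GrigorchukWitnessReturnDecay
import HarnessLib

/-!
# Door D12, item T5 (N2, assembly): on `Cay(𝔊 × ℤ; a,b,c,d,z)` a jump at `p_c` forces super-polynomially large slab susceptibility —
# conditional ONLY on the a-priori uniqueness zone (print-derived hypothesis) and a growth exponent

Proof file (`--supports stmt-CriticalPhenomena-4575`), lane `prim-bschramm`, seat `prim-bschramm-gen-1` gen 11 (GEN pen); item T5 of the design desk's D12 typing spec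
(p3 g41, bus 2026-08-29 #9231: "T5 N2 «Transplant/GrigorchukWitnessSlabSusceptJump.lean» (S, assembly): jump_forces_quasiPoly_slabSuscept : (∀o, UniquenessZone gzCay
(p_c o)) → ∀a ∈ (0,1), GrowthLower stdCay 1 a → ∀o, 0 < θ_o(p_c) → ∃c>0 ∃L₀ ∀L ≥ L₀ ∀B, SlabSusceptLE L B → ofReal(exp(c·log(L+2)^{a/(1−a)})) ≤ B (HarrisUniq
discharged by T-H ⇒ ONE print-conditional hypothesis), plus doorD12_print over it — the W2 analogue of N1").  builds on p205010 (kernel theorem, internal audit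
signed; external expert review pending) — nothing in this file uses p205010.  Def-free; no instance, no notation, no sorry, no `@[conjecture]`.  EVERYTHING here is
an implication: the uniqueness zone `∀ o, UniquenessZone gzCay (p_c o)` (Easo–Hutchcroft 2023 §2, to be derived from the printed Prop. 2.1 + Lemma 2.3 in T6), the
growth exponent and — for the door — the slab-susceptibility hypothesis K3″/K3′ are HYPOTHESES; the jump `θ_o(p_c) > 0` is a hypothesis of N2; NOTHING about
`θ(p_c)` on either witness is asserted and `gzCay_conj4` stays OPEN (it appears only as the conclusion of typed implications).

CONTENT (namespace `…Transplant.Grigorchuk.SlabSuscept`):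
* **`jump_forces_logSlabSuscept`** (N2): zone ∧ `GrowthLower stdCay 1 a` (`0 < a < 1`) ∧ jump at `o` ⇒ `log X(L) ≥ c (log(L+2))^{a/(1−a)}` for all `L ≥ L₀`
  (T4 `slabLogEngine` fed by T1+T2 `vertGluedIfJumpExp_gzCay_of_uniquenessZone`; Harris + uniqueness is kernel, T-H).
* **`doorD12_print`**: zone ∧ `0 < a < 1` ∧ `GrowthLower stdCay 1 a` ∧ `SlabSusceptQuasiPoly (a/(1−a))` ⇒ `gzCay_conj4`.
* **`doorD12_print_polySeq`** (the door of record's printed-exponent form): zone ∧ `GrowthLower stdCay 1 a` for some PRINT exponent `a ∈ (1/2, 1)` ∧ K3′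
  (`SlabSusceptPolySeq A`, polynomial slab susceptibility along a sequence) ⇒ `gzCay_conj4` (`a/(1−a) > 1`, T0 `quasiPoly_of_polySeq`).  Every honest instance
  of the door carries a PRINT exponent `a > 1/2` (design desk R-T5-1 / refuter #9391: with the kernel exponent alone, value uncontrolled, the door form would
  need K3″ at every `κ > 0`, which is false-looking for `κ ≤ 1` — so NO kernel-growth door is typed).
* **`jump_forces_logSlabSuscept_kernelGrowth`** (negation side, growth KERNEL): zone ∧ jump at `o` ⇒ `log X(L) ≥ c (log(L+2))^b` for SOME `b > 0` and all large
  `L` (`b = a′/(1−a′)`, `a′ = min a ½` from 1b's kernel exponent `stdCay_growthLower` via «GrigorchukWitnessReturnDecay» `growthLower_mono`).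
[cite: EasoHutchcroft2023, §2 (a-priori uniqueness zone)] [cite: BenjaminiSchramm1996, Conj. 4 (context: door D12)] [cite: Grigorchuk1984, Thm. (lower growth bound)]
[cite: Hutchcroft2016, Lemma 4]
-/

noncomputable section

namespace Summit.CriticalPhenomena.PercolationContinuityZ3.Theorems.Transplant

namespace Grigorchuk

namespace SlabSuscept

open SimpleGraph MeasureTheory Filter Literature.Barriers.CriticalPhenomena Literature.Probability.Percolation SnowballSqueeze LROSqueeze
open scoped Classical ENNReal

/-- **N2 — a jump at `p_c` forces `log X(𝔊 × [m, m+L]) ≥ c (log(L+2))^{a/(1−a)}` for all large `L`**, conditional ONLY on the a-priori uniqueness zone at `p_c`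
(print-derived HYPOTHESIS) and the growth exponent `a ∈ (0,1)` of `Cay(𝔊; a,b,c,d)`; the jump `θ_o(p_c) > 0` is the hypothesis being tested.  (T4 `slabLogEngine`
with the vertical gluing supplied by T1+T2 from the zone; Harris + uniqueness is KERNEL, T-H.)
[cite: EasoHutchcroft2023, §2 (a-priori uniqueness zone)] [cite: Hutchcroft2016, Lemma 4] [cite: Grigorchuk1984, Thm. (lower growth bound)] -/
theorem jump_forces_logSlabSuscept (hU : ∀ o : GZ, UniquenessZone gzCay (criticalProbIOf gzCay o)) {a : ℝ} (ha : 0 < a) (ha1 : a < 1)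
    (hG : GrowthLower stdCay (1 : ↥grigorchukGroup) a) (o : GZ) (hθ : 0 < theta gzCay o (criticalProbIOf gzCay o)) :
    ∃ c : ℝ, 0 < c ∧ ∃ L₀ : ℕ, ∀ (L : ℕ) (B : ℝ≥0∞), L₀ ≤ L → SlabSusceptLE L B →
      ENNReal.ofReal (Real.exp (c * Real.log ((L : ℝ) + 2) ^ (a / (1 - a)))) ≤ B :=
  slabLogEngine o a ha ha1 hG (vertGluedIfJumpExp_gzCay_of_uniquenessZone hU o) hθ

/-- **Door D12 with print-derived inputs**: zone ∧ `0 < a < 1` ∧ `GrowthLower stdCay 1 a` ∧ K3″(`a/(1−a)`) ⇒ `gzCay_conj4` (a typed implication; its hypotheses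
are NOT asserted, `gzCay_conj4` stays OPEN). [cite: BenjaminiSchramm1996, Conj. 4 (context: door D12)] [cite: EasoHutchcroft2023, §2 (a-priori uniqueness zone)] -/
theorem doorD12_print (hU : ∀ o : GZ, UniquenessZone gzCay (criticalProbIOf gzCay o)) {a : ℝ} (ha : 0 < a) (ha1 : a < 1)
    (hG : GrowthLower stdCay (1 : ↥grigorchukGroup) a) (hK : SlabSusceptQuasiPoly (a / (1 - a))) : gzCay_conj4 :=
  doorD12 a ha ha1 hG (vertGluedIfJumpExp_gzCay_of_uniquenessZone hU) hK

/-- **Door D12 from K3′ under a PRINT growth exponent `a > 1/2`** (Leonov 2000 / Bartholdi 2001: `a = 0.5157`; Erschler–Zheng 2020: every `a < 0.7674` — NOT in the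
tree; a HYPOTHESIS here): zone ∧ `GrowthLower stdCay 1 a` with `1/2 < a < 1` ∧ `SlabSusceptPolySeq A` (polynomial slab susceptibility along a sequence) ⇒ `gzCay_conj4`
(`a/(1−a) > 1`, T0 `quasiPoly_of_polySeq`).  A typed implication; nothing asserted. [cite: BenjaminiSchramm1996, Conj. 4 (context: door D12)]
[cite: Grigorchuk1984, Thm. (lower growth bound)] -/
theorem doorD12_print_polySeq (hU : ∀ o : GZ, UniquenessZone gzCay (criticalProbIOf gzCay o)) {a : ℝ} (ha : 1 / 2 < a) (ha1 : a < 1)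
    (hG : GrowthLower stdCay (1 : ↥grigorchukGroup) a) {A : ℝ} (hK : SlabSusceptPolySeq A) : gzCay_conj4 := by
  refine doorD12_print hU (by linarith) ha1 hG (quasiPoly_of_polySeq hK ?_)
  rw [lt_div_iff₀ (by linarith)]
  linarith

/-- **N2 with the growth input KERNEL (negation side)**: the zone and a jump at `o` force `log X(𝔊 × [m, m+L]) ≥ c (log(L+2))^b` for SOME `b > 0` and all
large `L` — `b = a′/(1−a′)` with `a′ = min a ½`, `a > 0` the kernel growth exponent of 1b `stdCay_growthLower` (value not controlled, hence only `∃ b > 0`).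
The zone is the ONE print-derived hypothesis; the jump is the hypothesis under test; nothing asserted. [cite: EasoHutchcroft2023, §2 (a-priori uniqueness zone)]
[cite: Grigorchuk1984, Thm. (lower growth bound)] [cite: Hutchcroft2016, Lemma 4] -/
theorem jump_forces_logSlabSuscept_kernelGrowth (hU : ∀ o : GZ, UniquenessZone gzCay (criticalProbIOf gzCay o)) (o : GZ)
    (hθ : 0 < theta gzCay o (criticalProbIOf gzCay o)) :
    ∃ b : ℝ, 0 < b ∧ ∃ c : ℝ, 0 < c ∧ ∃ L₀ : ℕ, ∀ (L : ℕ) (B : ℝ≥0∞), L₀ ≤ L → SlabSusceptLE L B →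
      ENNReal.ofReal (Real.exp (c * Real.log ((L : ℝ) + 2) ^ b)) ≤ B := by
  obtain ⟨a, ha, hGa⟩ := stdCay_growthLower
  have hmin : 0 < min a (1 / 2) := lt_min ha (by norm_num)
  have hmin1 : min a (1 / 2) < 1 := lt_of_le_of_lt (min_le_right _ _) (by norm_num)
  exact ⟨min a (1 / 2) / (1 - min a (1 / 2)), div_pos hmin (by linarith),
    jump_forces_logSlabSuscept hU hmin hmin1 (growthLower_mono (min_le_left _ _) (hGa 1)) o hθ⟩

end SlabSuscept

end Grigorchuk

end Summit.CriticalPhenomena.PercolationContinuityZ3.Theorems.Transplant
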